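import Literature.NumberTheory.Rogawski1990.ArchSingularCentralizerGlobalCoherence   -- ★ (W3) §1 `exists_conj_coherent_centralizer_family_of_base`, §2 `centralizer_pi_measure_conj_coherent`, ★ (W2), ★ C3
import Mathlib.LinearAlgebra.Matrix.Charpoly.Basic
import HarnessLib

/-!
# One conjugation-coherent torus datum for ALL split-singular wall data at once («(E4b)∕(W3-all)»; Rogawski (1990) §1.7 p. 6, §4.3 (4.3.1) p. 43, §8.2 pp. 122–124)

Topic `NumberTheory/Rogawski1990`.  THEOREMS ONLY (no definition, no instance, no notation, no named fact, no `sorry`).  Cell `pub/hodgecm-mathlib`, ENGINE T1, crux H413 =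
`stmt-HodgeConjecture-24833` (supports-only); the (ST-∞) dress, F0P3-p03 (g10) census `CENSUS-E4b-SingularPinsBuilt` 1291225b, brick (W3-all) after ★ (W3)
`ArchSingularCentralizerGlobalCoherence`.  Count-neutral plumbing.  HONEST LABEL: HC_CM is proved only modulo the printed citations until rung 0 closes; this file pays nothing.

WHY.  The (ST-∞) witness is ONE orbital measure family `ms′` on `U(H′)(L⁺ ⊗ ℝ)` serving every split-singular rational class at once, so its torus datum must be coherent on the union
of ALL wall classes `{q t(z⁰∘ρ) q⁻¹}` over all wall data `z⁰` (normal form `z⁰_w 0 = z⁰_w 2 ≠ z⁰_w 1` at every place); ★ (W3) §3∕§4 gives it for one `z⁰`.  Two wall data whose torus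
points are conjugate are EQUAL (conjugate diagonal matrices have the same eigenvalue multiset; the normal form pins the order), so the cross-datum base coherence of ★ (W3) §1 is
vacuous and one datum `T` serves all:
* §1 `wall_eq_of_count_eq` (a normal-form triple is determined by its value counts), `sum_ite_eq_of_conj_circleDiagonal` (conjugate diagonal torus points of `G_w(α) ≤ GL₃(ℂ)` have
  equal value counts: `Matrix.charpoly_units_conj`, `charpoly_diagonal`, `Polynomial.roots_multiset_prod_X_sub_C`), **`wall_eq_of_conj_archDiagTorus`** (conjugate wall torus points
  `t(z⁰₁∘ρ₁) ~ t(z⁰₂∘ρ₂)` in `U(diag α)(L⁺ ⊗ ℝ)` have `z⁰₁ = z⁰₂`).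
* §2 **`exists_conj_coherent_pinned_telescope_all`** — for an injective family of wall data `z0 : κ → …` with per-datum per-place coherent Haar inversion-invariant centraliser
  families: telescopes `ρP k ρ`, `ρ′ k ρ` (★ (D5)'s `hρPi hρP hρ′i hρ′` VERBATIM for each datum) and ONE torus datum `T` with `T (t(z0 k∘ρ)) = ρ′ k ρ`, Haar inversion-invariant and
  conjugation-coherent on the union of all wall classes; **`exists_conj_coherent_pinned_telescope_all_of_links`** — the same over ★ (D5)'s `νH ρZ hρZi hρZ` binders + the
  (T02)(T01) links + compact probability pins (per datum, ★ C3).  The END's `∀ z0 (hwall), ∃ ρZ … hq` (★ p07 (g9) `…_of_pinned`'s `hpinα∕hpinβ`) is read off with `κ :=` the subtype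
  of all wall data.

## References
* [Rogawski1990] J. D. Rogawski, *Automorphic Representations of Unitary Groups in Three Variables*, Ann. of Math. Stud. 123 (1990), §1.7 p. 6; §4.3 (4.3.1) p. 43; §8.2 pp. 122–124.
* [DeitmarEchterhoff2014] A. Deitmar, S. Echterhoff, *Principles of Harmonic Analysis*, 2nd ed. (2014), Thm. 1.5.3.
* [BrockerTomDieck1985] T. Bröcker, T. tom Dieck, *Representations of Compact Lie Groups* (1985), IV (3.1) (diagonal tori; conjugate diagonal elements are Weyl-related).
-/

set_option autoImplicit false

noncomputable section

open MeasureTheory Measure Set NumberField NumberField.InfinitePlace Matrix Equiv Polynomial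
open Literature.MeasureTheory.Group Literature.NumberTheory.Automorphic Literature.NumberTheory.Automorphic.UnitaryGroup
open scoped ENNReal NNReal Classical MatrixGroups

/-! ## §1 Conjugate wall torus points have equal wall data -/

namespace Literature.NumberTheory.Rogawski1990

/-- A wall triple in normal form (`d 0 = d 2 ≠ d 1`) is determined by its value counts among triples with `d' 0 = d' 2`. [cite: BrockerTomDieck1985, IV (3.1)] -/
theorem wall_eq_of_count_eq {d d' : Fin 3 → ℂ} (h0 : d 0 = d 2) (h1 : d 0 ≠ d 1) (h0' : d' 0 = d' 2)
    (h : ∀ x : ℂ, (∑ i : Fin 3, if x = d i then (1 : ℕ) else 0) = ∑ i : Fin 3, if x = d' i then (1 : ℕ) else 0) : d = d' := by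
  have ha := h (d 0)
  have hb := h (d 1)
  rw [Fin.sum_univ_three, Fin.sum_univ_three, if_pos rfl, if_neg h1, if_pos h0] at ha
  rw [Fin.sum_univ_three, Fin.sum_univ_three, if_neg (Ne.symm h1), if_pos rfl, if_neg (show ¬ d 1 = d 2 from fun h => h1 (h0.trans h.symm))] at hb
  have e0 : d 0 = d' 0 := by
    by_contra hne
    rw [if_neg hne, if_neg (show ¬ d 0 = d' 2 from fun h => hne (h.trans h0'.symm))] at ha
    split_ifs at ha <;> omega
  have e1 : d 1 = d' 1 := by
    by_contra hne
    have hne0 : d 1 ≠ d' 0 := fun h => h1 (e0.trans h.symm)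
    rw [if_neg hne0, if_neg hne, if_neg (show ¬ d 1 = d' 2 from fun h => hne0 (h.trans h0'.symm))] at hb
    omega
  funext i
  fin_cases i
  · exact e0
  · exact e1
  · show d 2 = d' 2
    rw [← h0, e0, h0']

/-- Value counts of a triple as root counts of `∏ (X − d i)`. [cite: BrockerTomDieck1985, IV (3.1)] -/
private theorem count_roots_prod_X_sub_C (d : Fin 3 → ℂ) (x : ℂ) :
    Multiset.count x (∏ i : Fin 3, (X - C (d i))).roots = ∑ i : Fin 3, if x = d i then (1 : ℕ) else 0 := by
  have h1 : (∏ i : Fin 3, (X - C (d i))) = ((Finset.univ.val.map d).map fun a => X - C a).prod := by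
    rw [Finset.prod_eq_multiset_prod, Multiset.map_map]
    rfl
  rw [h1, roots_multiset_prod_X_sub_C, Multiset.count_map, ← Finset.filter_val, Finset.card_val, Finset.card_filter]

variable (L : Type) [Field L] [NumberField L] [IsCMField L] (α : Fin 3 → L)

omit [NumberField L] [IsCMField L] in
/-- **Conjugate diagonal torus points of `G_w(α) ≤ GL₃(ℂ)` have equal value counts** (similar matrices have the same characteristic polynomial, Mathlib
`Matrix.charpoly_units_conj`; `charpoly (diagonal d) = ∏ (X − d i)`; relabelling by a permutation does not change counts). [cite: BrockerTomDieck1985, IV (3.1)] -/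
theorem sum_ite_eq_of_conj_circleDiagonal (w : {w : InfinitePlace L // IsComplex w}) (z z' : Fin 3 → Circle) (σ σ' : Perm (Fin 3)) (g : archLocal L 3 (Matrix.diagonal α) w)
    (hg : (MulAut.conj g : archLocal L 3 (Matrix.diagonal α) w ≃* archLocal L 3 (Matrix.diagonal α) w) (⟨circleDiagonal 3 (z ∘ ⇑σ), circleDiagonal_mem_archLocal_diagonal L 3 α w (z ∘ ⇑σ)⟩ : archLocal L 3 (Matrix.diagonal α) w) = (⟨circleDiagonal 3 (z' ∘ ⇑σ'), circleDiagonal_mem_archLocal_diagonal L 3 α w (z' ∘ ⇑σ')⟩ : archLocal L 3 (Matrix.diagonal α) w)) (x : ℂ) :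
    (∑ i : Fin 3, if x = (z i : ℂ) then (1 : ℕ) else 0) = ∑ i : Fin 3, if x = (z' i : ℂ) then (1 : ℕ) else 0 := by
  -- in `GL₃(ℂ)`, then in matrices
  have hGL : (g : GL (Fin 3) ℂ) * circleDiagonal 3 (z ∘ ⇑σ) * (g : GL (Fin 3) ℂ)⁻¹ = circleDiagonal 3 (z' ∘ ⇑σ') := by
    have h1 := congrArg Subtype.val hg
    simpa only [MulAut.conj_apply, Subgroup.coe_mul, Subgroup.coe_inv] using h1
  have hM : ((g : GL (Fin 3) ℂ) : Matrix (Fin 3) (Fin 3) ℂ) * Matrix.diagonal (fun i => ((z ∘ ⇑σ) i : ℂ)) * (((g : GL (Fin 3) ℂ) : Matrix (Fin 3) (Fin 3) ℂ))⁻¹ =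
      Matrix.diagonal (fun i => ((z' ∘ ⇑σ') i : ℂ)) := by
    have h1 := congrArg (fun u : GL (Fin 3) ℂ => (u : Matrix (Fin 3) (Fin 3) ℂ)) hGL
    simpa only [Units.val_mul, coe_circleDiagonal, Matrix.coe_units_inv] using h1
  have hchar : (Matrix.diagonal (fun i => ((z ∘ ⇑σ) i : ℂ))).charpoly = (Matrix.diagonal (fun i => ((z' ∘ ⇑σ') i : ℂ))).charpoly := by
    rw [← hM, Matrix.charpoly_units_conj]
  rw [Matrix.charpoly_diagonal, Matrix.charpoly_diagonal] at hchar
  have hcount := congrArg (fun p : ℂ[X] => Multiset.count x p.roots) hchar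
  simp only [count_roots_prod_X_sub_C, Function.comp_apply] at hcount
  -- undo the relabellings
  rw [Equiv.sum_comp σ (fun i => if x = (z i : ℂ) then (1 : ℕ) else 0), Equiv.sum_comp σ' (fun i => if x = (z' i : ℂ) then (1 : ℕ) else 0)] at hcount
  exact hcount

/-- **CONJUGATE WALL TORUS POINTS HAVE EQUAL WALL DATA.**  If `Q t(z⁰₁∘ρ₁) Q⁻¹ = t(z⁰₂∘ρ₂)` in `U(diag α)(L⁺ ⊗ ℝ)` for wall data in normal form (`z⁰_w 0 = z⁰_w 2 ≠ z⁰_w 1` at every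
place), then `z⁰₁ = z⁰₂`: place by place (★ (W3) `conj_archPiEquivCM_apply_circleDiagonal_of_conj_archDiagTorus`) the diagonal points are conjugate in `G_w(α) ≤ GL₃(ℂ)`, so their
value counts agree, and the normal form pins the triple. [cite: BrockerTomDieck1985, IV (3.1)] [cite: Rogawski1990, §1.7 p. 6] -/
theorem wall_eq_of_conj_archDiagTorus (z₀ z₀' : {w : InfinitePlace L // IsComplex w} → Fin 3 → Circle) (hw : ∀ w, z₀ w 0 = z₀ w 2 ∧ z₀ w 0 ≠ z₀ w 1) (hw' : ∀ w, z₀' w 0 = z₀' w 2)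
    (ρ₁ ρ₂ : {w : InfinitePlace L // IsComplex w} → Perm (Fin 3)) (Q : arch (↥(maximalRealSubfield L)) L (IsCMField.complexConj L) 3 (Matrix.diagonal α))
    (hQ : (MulAut.conj Q : arch (↥(maximalRealSubfield L)) L (IsCMField.complexConj L) 3 (Matrix.diagonal α) ≃* arch (↥(maximalRealSubfield L)) L (IsCMField.complexConj L) 3 (Matrix.diagonal α)) (archDiagTorus L 3 α (fun w => z₀ w ∘ ⇑(ρ₁ w))) = archDiagTorus L 3 α (fun w => z₀' w ∘ ⇑(ρ₂ w))) :
    z₀ = z₀' := by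
  funext w
  -- place by place: the components `(e Q)_w` conjugate the diagonal points
  have h1 : (archPiEquivCM 3 L (Matrix.diagonal α)) (archDiagTorus L 3 α (fun w => z₀ w ∘ ⇑(ρ₁ w))) = fun w => (⟨circleDiagonal 3 (z₀ w ∘ ⇑(ρ₁ w)), circleDiagonal_mem_archLocal_diagonal L 3 α w (z₀ w ∘ ⇑(ρ₁ w))⟩ : archLocal L 3 (Matrix.diagonal α) w) := by
    rw [← archPiEquivCM_symm_circleDiagonal_eq_archDiagTorus L 3 α (fun w => z₀ w ∘ ⇑(ρ₁ w)), ContinuousMulEquiv.apply_symm_apply]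
  have h2 : (archPiEquivCM 3 L (Matrix.diagonal α)) (archDiagTorus L 3 α (fun w => z₀' w ∘ ⇑(ρ₂ w))) = fun w => (⟨circleDiagonal 3 (z₀' w ∘ ⇑(ρ₂ w)), circleDiagonal_mem_archLocal_diagonal L 3 α w (z₀' w ∘ ⇑(ρ₂ w))⟩ : archLocal L 3 (Matrix.diagonal α) w) := by
    rw [← archPiEquivCM_symm_circleDiagonal_eq_archDiagTorus L 3 α (fun w => z₀' w ∘ ⇑(ρ₂ w)), ContinuousMulEquiv.apply_symm_apply]
  have h3 := congrArg (fun g => (archPiEquivCM 3 L (Matrix.diagonal α)) g w) hQ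
  simp only [MulAut.conj_apply, map_mul, map_inv, Pi.mul_apply, Pi.inv_apply] at h3
  rw [h1, h2] at h3
  have hcount := sum_ite_eq_of_conj_circleDiagonal L α w (z₀ w) (z₀' w) (ρ₁ w) (ρ₂ w) ((archPiEquivCM 3 L (Matrix.diagonal α)) Q w) (by simpa only [MulAut.conj_apply] using h3)
  have hd := wall_eq_of_count_eq (d := fun i => (z₀ w i : ℂ)) (d' := fun i => (z₀' w i : ℂ)) (congrArg _ (hw w).1) (fun h => (hw w).2 (Circle.ext h))
    (congrArg _ (hw' w)) hcount
  funext i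
  exact Circle.ext (congrFun hd i)

end Literature.NumberTheory.Rogawski1990

/-! ## §2 One coherent torus datum for all wall data -/

namespace Literature.NumberTheory.Rogawski1990

variable (L : Type) [Field L] [NumberField L] [IsCMField L] (α : Fin 3 → L)
  [MeasurableSpace (arch (↥(maximalRealSubfield L)) L (IsCMField.complexConj L) 3 (Matrix.diagonal α))] [BorelSpace (arch (↥(maximalRealSubfield L)) L (IsCMField.complexConj L) 3 (Matrix.diagonal α))]

section Abstract

variable [∀ w : {w : InfinitePlace L // IsComplex w}, MeasurableSpace (archLocal L 3 (Matrix.diagonal α) w)] [∀ w : {w : InfinitePlace L // IsComplex w}, BorelSpace (archLocal L 3 (Matrix.diagonal α) w)]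
  [iSC : ∀ w : {w : InfinitePlace L // IsComplex w}, SecondCountableTopology (archLocal L 3 (Matrix.diagonal α) w)] [iLC : ∀ w : {w : InfinitePlace L // IsComplex w}, LocallyCompactSpace (archLocal L 3 (Matrix.diagonal α) w)]

/-- **(W3-all) ONE COHERENT PINNED TORUS DATUM FOR AN INJECTIVE FAMILY OF WALL DATA.**  For wall data `z0 k` (`k : κ`, injective, normal form at every place) and per-datum
per-place Haar inversion-invariant centraliser families `ρZ k w σ` on the `Z_w(diag(z0 k w∘σ))`, coherent under `G_w(α)`-conjugation: telescopes `ρP k ρ`, `ρ′ k ρ` with ★ (D5)'s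
`hρPi hρP hρ′i hρ′` for every datum (★ (W2)), and ONE torus datum `T` on `U(diag α)(L⁺ ⊗ ℝ)` with `T (t(z0 k∘ρ)) = ρ′ k ρ`, a conjugation transport of some `ρ′ k ρ` — hence Haar
and inversion invariant — at every point of the union of the wall classes, and COHERENT UNDER EVERY CONJUGATOR there (★ (W3) §1; base coherence within a datum = ★ (W3) §2, across
data vacuous by `wall_eq_of_conj_archDiagTorus` + injectivity). [cite: Rogawski1990, §1.7 p. 6; §4.3 (4.3.1) p. 43; §8.2 pp. 122–124] [cite: DeitmarEchterhoff2014, Thm. 1.5.3] -/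
theorem exists_conj_coherent_pinned_telescope_all {κ : Type*} (z0 : κ → {w : InfinitePlace L // IsComplex w} → Fin 3 → Circle) (hinj : Function.Injective z0)
    (hwall : ∀ k w, z0 k w 0 = z0 k w 2 ∧ z0 k w 0 ≠ z0 k w 1)
    (ρZ : ∀ (k : κ) (w : {w : InfinitePlace L // IsComplex w}) (σ : Perm (Fin 3)), Measure (Subgroup.centralizer ({(⟨circleDiagonal 3 (z0 k w ∘ ⇑σ), circleDiagonal_mem_archLocal_diagonal L 3 α w (z0 k w ∘ ⇑σ)⟩ : archLocal L 3 (Matrix.diagonal α) w)} : Set (archLocal L 3 (Matrix.diagonal α) w))))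
    (hρZi : ∀ k w σ, (ρZ k w σ).IsHaarMeasure ∧ (ρZ k w σ).IsInvInvariant)
    (hcohw : ∀ (k : κ) (w : {w : InfinitePlace L // IsComplex w}) (σ₁ σ₂ : Perm (Fin 3)) (g : archLocal L 3 (Matrix.diagonal α) w) (hg : (MulAut.conj g : archLocal L 3 (Matrix.diagonal α) w ≃* archLocal L 3 (Matrix.diagonal α) w) (⟨circleDiagonal 3 (z0 k w ∘ ⇑σ₁), circleDiagonal_mem_archLocal_diagonal L 3 α w (z0 k w ∘ ⇑σ₁)⟩ : archLocal L 3 (Matrix.diagonal α) w) = (⟨circleDiagonal 3 (z0 k w ∘ ⇑σ₂), circleDiagonal_mem_archLocal_diagonal L 3 α w (z0 k w ∘ ⇑σ₂)⟩ : archLocal L 3 (Matrix.diagonal α) w)),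
      (ρZ k w σ₁).map (subgroupCongrHomeomorph (MulAut.conj g : archLocal L 3 (Matrix.diagonal α) w ≃* archLocal L 3 (Matrix.diagonal α) w) (Subgroup.centralizer ({(⟨circleDiagonal 3 (z0 k w ∘ ⇑σ₁), circleDiagonal_mem_archLocal_diagonal L 3 α w (z0 k w ∘ ⇑σ₁)⟩ : archLocal L 3 (Matrix.diagonal α) w)} : Set (archLocal L 3 (Matrix.diagonal α) w))) (Subgroup.centralizer ({(⟨circleDiagonal 3 (z0 k w ∘ ⇑σ₂), circleDiagonal_mem_archLocal_diagonal L 3 α w (z0 k w ∘ ⇑σ₂)⟩ : archLocal L 3 (Matrix.diagonal α) w)} : Set (archLocal L 3 (Matrix.diagonal α) w))) (forall_apply_mem_centralizer_singleton_iff_of_eq (MulAut.conj g : archLocal L 3 (Matrix.diagonal α) w ≃* archLocal L 3 (Matrix.diagonal α) w) hg) (continuous_mulAutConj g) (continuous_mulAutConj_symm g)) = ρZ k w σ₂) :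
    ∃ (ρP : ∀ (k : κ) (ρ : {w : InfinitePlace L // IsComplex w} → Perm (Fin 3)), Measure (Subgroup.pi Set.univ (fun w : {w : InfinitePlace L // IsComplex w} => Subgroup.centralizer ({(⟨circleDiagonal 3 (z0 k w ∘ ⇑(ρ w)), circleDiagonal_mem_archLocal_diagonal L 3 α w (z0 k w ∘ ⇑(ρ w))⟩ : archLocal L 3 (Matrix.diagonal α) w)} : Set (archLocal L 3 (Matrix.diagonal α) w)))))
      (ρ' : ∀ (k : κ) (ρ : {w : InfinitePlace L // IsComplex w} → Perm (Fin 3)), Measure (Subgroup.centralizer ({archDiagTorus L 3 α (fun w => z0 k w ∘ ⇑(ρ w))} : Set (arch (↥(maximalRealSubfield L)) L (IsCMField.complexConj L) 3 (Matrix.diagonal α)))))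
      (T : ∀ γ : arch (↥(maximalRealSubfield L)) L (IsCMField.complexConj L) 3 (Matrix.diagonal α), Measure (Subgroup.centralizer ({γ} : Set (arch (↥(maximalRealSubfield L)) L (IsCMField.complexConj L) 3 (Matrix.diagonal α))))),
      (∀ k ρ, (ρP k ρ).IsHaarMeasure ∧ (ρP k ρ).IsInvInvariant) ∧
      (∀ (k : κ) (ρ : {w : InfinitePlace L // IsComplex w} → Perm (Fin 3)), Measure.map (subgroupPiCoords fun w : {w : InfinitePlace L // IsComplex w} => Subgroup.centralizer ({(⟨circleDiagonal 3 (z0 k w ∘ ⇑(ρ w)), circleDiagonal_mem_archLocal_diagonal L 3 α w (z0 k w ∘ ⇑(ρ w))⟩ : archLocal L 3 (Matrix.diagonal α) w)} : Set (archLocal L 3 (Matrix.diagonal α) w))) (ρP k ρ) = Measure.pi fun w => ρZ k w (ρ w)) ∧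
      (∀ k ρ, (ρ' k ρ).IsHaarMeasure ∧ (ρ' k ρ).IsInvInvariant) ∧
      (∀ (k : κ) (ρ : {w : InfinitePlace L // IsComplex w} → Perm (Fin 3)), ρ' k ρ = (ρP k ρ).map (subgroupCongrHomeomorph (archPiEquivCM 3 L (Matrix.diagonal α)).symm.toMulEquiv (Subgroup.pi Set.univ (fun w : {w : InfinitePlace L // IsComplex w} => Subgroup.centralizer ({(⟨circleDiagonal 3 (z0 k w ∘ ⇑(ρ w)), circleDiagonal_mem_archLocal_diagonal L 3 α w (z0 k w ∘ ⇑(ρ w))⟩ : archLocal L 3 (Matrix.diagonal α) w)} : Set (archLocal L 3 (Matrix.diagonal α) w)))) (Subgroup.centralizer ({archDiagTorus L 3 α (fun w => z0 k w ∘ ⇑(ρ w))} : Set (arch (↥(maximalRealSubfield L)) L (IsCMField.complexConj L) 3 (Matrix.diagonal α)))) (apply_mem_centralizer_iff_mem_pi_centralizer _ (archPiEquivCM 3 L (Matrix.diagonal α)).symm.toMulEquiv (archPiEquivCM_symm_circleDiagonal_eq_archDiagTorus L 3 α (fun w => z0 k w ∘ ⇑(ρ w)))) (archPiEquivCM 3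 L (Matrix.diagonal α)).symm.continuous (archPiEquivCM 3 L (Matrix.diagonal α)).continuous)) ∧
      (∀ (k : κ) (ρ : {w : InfinitePlace L // IsComplex w} → Perm (Fin 3)), T (archDiagTorus L 3 α (fun w => z0 k w ∘ ⇑(ρ w))) = ρ' k ρ) ∧
      (∀ γ : arch (↥(maximalRealSubfield L)) L (IsCMField.complexConj L) 3 (Matrix.diagonal α), (∃ (k : κ) (ρ : {w : InfinitePlace L // IsComplex w} → Perm (Fin 3)) (q : arch (↥(maximalRealSubfield L)) L (IsCMField.complexConj L) 3 (Matrix.diagonal α)), (MulAut.conj q : arch (↥(maximalRealSubfield L)) L (IsCMField.complexConj L) 3 (Matrix.diagonal α) ≃* arch (↥(maximalRealSubfield L)) L (IsCMField.complexConj L) 3 (Matrix.diagonal α)) (archDiagTorus L 3 α (fun w => z0 k w ∘ ⇑(ρ w))) = γ) →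
        ∃ (k : κ) (ρ : {w : InfinitePlace L // IsComplex w} → Perm (Fin 3)) (q : arch (↥(maximalRealSubfield L)) L (IsCMField.complexConj L) 3 (Matrix.diagonal α)) (h : (MulAut.conj q : arch (↥(maximalRealSubfield L)) L (IsCMField.complexConj L) 3 (Matrix.diagonal α) ≃* arch (↥(maximalRealSubfield L)) L (IsCMField.complexConj L) 3 (Matrix.diagonal α)) (archDiagTorus L 3 α (fun w => z0 k w ∘ ⇑(ρ w))) = γ), T γ = (ρ' k ρ).map (subgroupCongrHomeomorph (MulAut.conj q : arch (↥(maximalRealSubfield L)) L (IsCMField.complexConj L) 3 (Matrix.diagonal α) ≃* arch (↥(maximalRealSubfield L)) L (IsCMField.complexConj L) 3 (Matrix.diagonal α)) (Subgroup.centralizer ({archDiagTorus L 3 α (fun w => z0 k w ∘ ⇑(ρ w))} : Set (arch (↥(maximalRealSubfield L)) L (IsCMField.complexConj L) 3 (Matrix.diagonal α)))) (Subgroup.centralizer ({γ} : Set (arch (↥(maximalRealSubfield L)) L (IsCMField.complexConj L) 3 (Matrix.diagonal α)))) (forall_apply_mem_centralizer_singleton_iff_of_eq (MulAut.conj q : arch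 (↥(maximalRealSubfield L)) L (IsCMField.complexConj L) 3 (Matrix.diagonal α) ≃* arch (↥(maximalRealSubfield L)) L (IsCMField.complexConj L) 3 (Matrix.diagonal α)) h) (continuous_mulAutConj q) (continuous_mulAutConj_symm q))) ∧
      (∀ γ : arch (↥(maximalRealSubfield L)) L (IsCMField.complexConj L) 3 (Matrix.diagonal α), (∃ (k : κ) (ρ : {w : InfinitePlace L // IsComplex w} → Perm (Fin 3)) (q : arch (↥(maximalRealSubfield L)) L (IsCMField.complexConj L) 3 (Matrix.diagonal α)), (MulAut.conj q : arch (↥(maximalRealSubfield L)) L (IsCMField.complexConj L) 3 (Matrix.diagonal α) ≃* arch (↥(maximalRealSubfield L)) L (IsCMField.complexConj L) 3 (Matrix.diagonal α)) (archDiagTorus L 3 α (fun w => z0 k w ∘ ⇑(ρ w))) = γ) → (T γ).IsHaarMeasure ∧ (T γ).IsInvInvariant) ∧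
      ∀ (γ₁ γ₂ Q : arch (↥(maximalRealSubfield L)) L (IsCMField.complexConj L) 3 (Matrix.diagonal α)) (hQ : (MulAut.conj Q : arch (↥(maximalRealSubfield L)) L (IsCMField.complexConj L) 3 (Matrix.diagonal α) ≃* arch (↥(maximalRealSubfield L)) L (IsCMField.complexConj L) 3 (Matrix.diagonal α)) γ₁ = γ₂), (∃ (k : κ) (ρ : {w : InfinitePlace L // IsComplex w} → Perm (Fin 3)) (q : arch (↥(maximalRealSubfield L)) L (IsCMField.complexConj L) 3 (Matrix.diagonal α)), (MulAut.conj q : arch (↥(maximalRealSubfield L)) L (IsCMField.complexConj L) 3 (Matrix.diagonal α) ≃* arch (↥(maximalRealSubfield L)) L (IsCMField.complexConj L) 3 (Matrix.diagonal α)) (archDiagTorus L 3 α (fun w => z0 k w ∘ ⇑(ρ w))) = γ₁) →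
        (T γ₁).map (subgroupCongrHomeomorph (MulAut.conj Q : arch (↥(maximalRealSubfield L)) L (IsCMField.complexConj L) 3 (Matrix.diagonal α) ≃* arch (↥(maximalRealSubfield L)) L (IsCMField.complexConj L) 3 (Matrix.diagonal α)) (Subgroup.centralizer ({γ₁} : Set (arch (↥(maximalRealSubfield L)) L (IsCMField.complexConj L) 3 (Matrix.diagonal α)))) (Subgroup.centralizer ({γ₂} : Set (arch (↥(maximalRealSubfield L)) L (IsCMField.complexConj L) 3 (Matrix.diagonal α)))) (forall_apply_mem_centralizer_singleton_iff_of_eq (MulAut.conj Q : arch (↥(maximalRealSubfield L)) L (IsCMField.complexConj L) 3 (Matrix.diagonal α) ≃* arch (↥(maximalRealSubfield L)) L (IsCMField.complexConj L) 3 (Matrix.diagonal α)) hQ) (continuous_mulAutConj Q) (continuous_mulAutConj_symm Q)) = T γ₂ := by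
  -- telescopes per datum and relabelling: ★ (W2)
  have hW2 := fun (k : κ) (ρ : {w : InfinitePlace L // IsComplex w} → Perm (Fin 3)) =>
    exists_pi_centralizer_measures L 3 α (fun w => z0 k w ∘ ⇑(ρ w)) (fun w => ρZ k w (ρ w)) (fun w => hρZi k w (ρ w))
  choose ρP ρ' hρPi hρP hρ'i hρ' using hW2
  -- base coherence on `κ × (W → Perm)`: across data vacuous (equal data), within a datum ★ (W3) §2
  have hbase : ∀ (i j : κ × ({w : InfinitePlace L // IsComplex w} → Perm (Fin 3))) (Q : arch (↥(maximalRealSubfield L)) L (IsCMField.complexConj L) 3 (Matrix.diagonal α))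
      (hQ : (MulAut.conj Q : arch (↥(maximalRealSubfield L)) L (IsCMField.complexConj L) 3 (Matrix.diagonal α) ≃* arch (↥(maximalRealSubfield L)) L (IsCMField.complexConj L) 3 (Matrix.diagonal α)) (archDiagTorus L 3 α (fun w => z0 i.1 w ∘ ⇑(i.2 w))) = archDiagTorus L 3 α (fun w => z0 j.1 w ∘ ⇑(j.2 w))),
      (ρ' i.1 i.2).map (subgroupCongrHomeomorph (MulAut.conj Q : arch (↥(maximalRealSubfield L)) L (IsCMField.complexConj L) 3 (Matrix.diagonal α) ≃* arch (↥(maximalRealSubfield L)) L (IsCMField.complexConj L) 3 (Matrix.diagonal α)) (Subgroup.centralizer ({archDiagTorus L 3 α (fun w => z0 i.1 w ∘ ⇑(i.2 w))} : Set (arch (↥(maximalRealSubfield L)) L (IsCMField.complexConj L) 3 (Matrix.diagonal α)))) (Subgroup.centralizer ({archDiagTorus L 3 α (fun w => z0 j.1 w ∘ ⇑(j.2 w))} : Set (arch (↥(maximalRealSubfield L)) L (IsCMField.complexConj L) 3 (Matrix.diagonal α)))) (forall_apply_mem_centralizer_singleton_iff_of_eq (MulAut.conj Q : arch (↥(maximalRealSubfield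 L)) L (IsCMField.complexConj L) 3 (Matrix.diagonal α) ≃* arch (↥(maximalRealSubfield L)) L (IsCMField.complexConj L) 3 (Matrix.diagonal α)) hQ) (continuous_mulAutConj Q) (continuous_mulAutConj_symm Q)) = ρ' j.1 j.2 := by
    rintro ⟨k₁, ρ₁⟩ ⟨k₂, ρ₂⟩ Q hQ
    obtain rfl : k₁ = k₂ := hinj (wall_eq_of_conj_archDiagTorus L α (z0 k₁) (z0 k₂) (hwall k₁) (fun w => (hwall k₂ w).1) ρ₁ ρ₂ Q hQ)
    exact centralizer_pi_measure_conj_coherent L α (z0 k₁) (ρZ k₁) (hρZi k₁) (hcohw k₁) (ρP k₁) (hρP k₁) (ρ' k₁) (hρ' k₁) ρ₁ ρ₂ Q hQ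
  obtain ⟨T, hTb, hTpres, hTcoh⟩ := Literature.NumberTheory.Automorphic.exists_conj_coherent_centralizer_family_of_base
    (fun i : κ × ({w : InfinitePlace L // IsComplex w} → Perm (Fin 3)) => archDiagTorus L 3 α (fun w => z0 i.1 w ∘ ⇑(i.2 w))) (fun i => ρ' i.1 i.2) hbase
  -- repackage the index `κ × (W → Perm)` as `k, ρ`
  have hsat : ∀ γ : arch (↥(maximalRealSubfield L)) L (IsCMField.complexConj L) 3 (Matrix.diagonal α), (∃ (k : κ) (ρ : {w : InfinitePlace L // IsComplex w} → Perm (Fin 3)) (q : arch (↥(maximalRealSubfield L)) L (IsCMField.complexConj L) 3 (Matrix.diagonal α)), (MulAut.conj q : arch (↥(maximalRealSubfield L)) L (IsCMField.complexConj L) 3 (Matrix.diagonal α) ≃* arch (↥(maximalRealSubfield L)) L (IsCMField.complexConj L) 3 (Matrix.diagonal α)) (archDiagTorus L 3 α (fun w => z0 k w ∘ ⇑(ρ w))) = γ) →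
      ∃ (i : κ × ({w : InfinitePlace L // IsComplex w} → Perm (Fin 3))) (q₀ : arch (↥(maximalRealSubfield L)) L (IsCMField.complexConj L) 3 (Matrix.diagonal α)), (MulAut.conj q₀ : arch (↥(maximalRealSubfield L)) L (IsCMField.complexConj L) 3 (Matrix.diagonal α) ≃* arch (↥(maximalRealSubfield L)) L (IsCMField.complexConj L) 3 (Matrix.diagonal α)) (archDiagTorus L 3 α (fun w => z0 i.1 w ∘ ⇑(i.2 w))) = γ :=
    fun γ ⟨k, ρ, q, h⟩ => ⟨(k, ρ), q, h⟩
  refine ⟨ρP, ρ', T, hρPi, hρP, hρ'i, hρ', fun k ρ => hTb (k, ρ), fun γ hγ => ?_, fun γ hγ => ?_,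
    fun γ₁ γ₂ Q hQ hγ₁ => hTcoh γ₁ γ₂ Q hQ (hsat γ₁ hγ₁)⟩
  · obtain ⟨i, q, h, hT⟩ := hTpres γ (hsat γ hγ)
    exact ⟨i.1, i.2, q, h, hT⟩
  · obtain ⟨i, q, h, hT⟩ := hTpres γ (hsat γ hγ)
    haveI := (hρ'i i.1 i.2).1
    haveI := (hρ'i i.1 i.2).2
    haveI : LocallyCompactSpace (Subgroup.centralizer ({archDiagTorus L 3 α (fun w => z0 i.1 w ∘ ⇑(i.2 w))} : Set (arch (↥(maximalRealSubfield L)) L (IsCMField.complexConj L) 3 (Matrix.diagonal α)))) := (isClosed_coe_centralizer_singleton _).isClosedEmbedding_subtypeVal.locallyCompactSpace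
    rw [hT]
    exact ⟨isHaarMeasure_map_subgroupCongrHomeomorph _ _ _ _ _ _ (ρ' i.1 i.2), isInvInvariant_map_subgroupCongrHomeomorph _ _ _ _ _ _ (ρ' i.1 i.2)⟩

end Abstract

/-! ## §3 For the actual pins (★ C3 per datum) -/

section Pins

variable [MeasurableSpace (GL (Fin 3) ℂ)] [BorelSpace (GL (Fin 3) ℂ)]

/-- **(W3-all) FOR THE ACTUAL PINS.**  §2 with the per-datum per-place coherence discharged by ★ C3 `centralizer_measure_family_conj_coherent`: over ★ (D5)'s `νH ρZ hρZi hρZ` binders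
(`ρZ`, `hρZ`, `hρZ1`, `hρZi` per wall datum `z0 k`; the reference measures `νH w τ` at the reference wall point `z₁ w` and their (T02)(T01) links do not depend on the datum).  With
`κ :=` the subtype of all wall data in normal form and `z0 := Subtype.val`, this is the `∀ z0 (hwall), ∃ ρZ … hρZ ∧ hM ∧ hρP ∧ hρ′ ∧ hq` feed of the (ST-∞-s) END for ONE family.
[cite: Rogawski1990, §1.7 p. 6; §4.3 (4.3.1) p. 43; §8.2 pp. 122–124; §14.5 p. 238] [cite: DeitmarEchterhoff2014, Thm. 1.5.3] -/
theorem exists_conj_coherent_pinned_telescope_all_of_links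
    (hα : ∀ i, α i ≠ 0) (hreal : ∀ (w : {w : InfinitePlace L // IsComplex w}) (i : Fin 3), (w.1.embedding (α i)).im = 0)
    (z₁ : {w : InfinitePlace L // IsComplex w} → Fin 3 → Circle) (h02 : ∀ w, z₁ w 0 = z₁ w 2) (h01 : ∀ w, z₁ w 0 ≠ z₁ w 1)
    (νH : ∀ (w : {w : InfinitePlace L // IsComplex w}) (τ : Perm (Fin 3)), Measure (Subgroup.centralizer ({(⟨circleDiagonal 3 (z₁ w), circleDiagonal_mem_archLocal_diagonal L 3 (α ∘ ⇑τ) w (z₁ w)⟩ : archLocal L 3 (Matrix.diagonal (α ∘ ⇑τ)) w)} : Set (archLocal L 3 (Matrix.diagonal (α ∘ ⇑τ)) w))))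
    (hT02 : ∀ (w : {w : InfinitePlace L // IsComplex w}) (τ : Perm (Fin 3)), (w.1.embedding (α (τ 0))).re * (w.1.embedding (α (τ 2))).re < 0 →
      νH w τ = (νH w (τ * Equiv.swap (0 : Fin 3) 2)).map (subgroupCongrHomeomorph (ContinuousMulEquiv.restrictSubgroup (GLn.conjEquiv (Matrix.GeneralLinearGroup.mkOfDetNeZero _ (det_monomial_one_ne_zero 3 (Equiv.swap (0 : Fin 3) 2)))) (archLocal L 3 (Matrix.diagonal ((α ∘ ⇑τ) ∘ ⇑(Equiv.swap (0 : Fin 3) 2))) w) (archLocal L 3 (Matrix.diagonal (α ∘ ⇑τ)) w) (mem_archLocal_comp_perm_iff_conj_mem L 3 (α ∘ ⇑τ) w (Equiv.swap (0 : Fin 3) 2))).toMulEquiv (Subgroup.centralizer ({(⟨circleDiagonal 3 (z₁ w), circleDiagonal_mem_archLocal_diagonal L 3 ((α ∘ ⇑τ) ∘ ⇑(Equiv.swap (0 : Fin 3) 2)) w (z₁ w)⟩ : archLocal L 3 (Matrix.diagonal ((α ∘ ⇑τ) ∘ ⇑(Equiv.swap (0 : Fin 3) 2))) w)} : Set (archLocal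 L 3 (Matrix.diagonal ((α ∘ ⇑τ) ∘ ⇑(Equiv.swap (0 : Fin 3) 2))) w))) (Subgroup.centralizer ({(⟨circleDiagonal 3 (z₁ w), circleDiagonal_mem_archLocal_diagonal L 3 (α ∘ ⇑τ) w (z₁ w)⟩ : archLocal L 3 (Matrix.diagonal (α ∘ ⇑τ)) w)} : Set (archLocal L 3 (Matrix.diagonal (α ∘ ⇑τ)) w))) (forall_apply_mem_centralizer_singleton_iff_of_eq (ContinuousMulEquiv.restrictSubgroup (GLn.conjEquiv (Matrix.GeneralLinearGroup.mkOfDetNeZero _ (det_monomial_one_ne_zero 3 (Equiv.swap (0 : Fin 3) 2)))) (archLocal L 3 (Matrix.diagonal ((α ∘ ⇑τ) ∘ ⇑(Equiv.swap (0 : Fin 3) 2))) w) (archLocal L 3 (Matrix.diagonal (α ∘ ⇑τ)) w) (mem_archLocal_comp_perm_iff_conj_mem L 3 (α ∘ ⇑τ) w (Equiv.swap (0 : Fin 3) 2))).toMulEquiv ((relabel_circleDiagonal L 3 (α ∘ ⇑τ) w (Equiv.swap (0 : Fin 3) 2) (z₁ w)).trans (Subtype.ext (congrArg (circleDiagonal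 3) (comp_swap02_symm_eq_self_of_wall (z₁ w) (h02 w)))))) (ContinuousMulEquiv.restrictSubgroup (GLn.conjEquiv (Matrix.GeneralLinearGroup.mkOfDetNeZero _ (det_monomial_one_ne_zero 3 (Equiv.swap (0 : Fin 3) 2)))) (archLocal L 3 (Matrix.diagonal ((α ∘ ⇑τ) ∘ ⇑(Equiv.swap (0 : Fin 3) 2))) w) (archLocal L 3 (Matrix.diagonal (α ∘ ⇑τ)) w) (mem_archLocal_comp_perm_iff_conj_mem L 3 (α ∘ ⇑τ) w (Equiv.swap (0 : Fin 3) 2))).continuous (ContinuousMulEquiv.restrictSubgroup (GLn.conjEquiv (Matrix.GeneralLinearGroup.mkOfDetNeZero _ (det_monomial_one_ne_zero 3 (Equiv.swap (0 : Fin 3) 2)))) (archLocal L 3 (Matrix.diagonal ((α ∘ ⇑τ) ∘ ⇑(Equiv.swap (0 : Fin 3) 2))) w) (archLocal L 3 (Matrix.diagonal (α ∘ ⇑τ)) w) (mem_archLocal_comp_perm_iff_conj_mem L 3 (α ∘ ⇑τ) w (Equiv.swap (0 : Fin 3) 2))).symm.continuous))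
    (hT01 : ∀ (w : {w : InfinitePlace L // IsComplex w}) (τ : Perm (Fin 3)), (w.1.embedding (α (τ 0))).re * (w.1.embedding (α (τ 2))).re < 0 →
      ∀ (h01s : 0 < (w.1.embedding ((α ∘ ⇑τ) 0)).re * (w.1.embedding ((α ∘ ⇑τ) 1)).re),
      νH w (τ * Equiv.swap (0 : Fin 3) 1) = (νH w τ).map (subgroupCongrHomeomorph (ContinuousMulEquiv.restrictSubgroup (GLn.conjEquiv (Matrix.GeneralLinearGroup.mkOfDetNeZero (Matrix.diagonal ![((Real.sqrt ((w.1.embedding ((α ∘ ⇑τ) 0)).re / (w.1.embedding ((α ∘ ⇑τ) 1)).re) : ℝ) : ℂ), ((Real.sqrt ((w.1.embedding ((α ∘ ⇑τ) 1)).re / (w.1.embedding ((α ∘ ⇑τ) 0)).re) : ℝ) : ℂ), 1]) (det_rescale01_ne_zero h01s))) (archLocal L 3 (Matrix.diagonal (α ∘ ⇑τ)) w) (archLocal L 3 (Matrix.diagonal ((α ∘ ⇑τ) ∘ ⇑(Equiv.swap (0 : Fin 3) 1))) w) (mem_archLocal_diagonal_iff_conjEquiv_mem_of_formCongr_eq L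 3 (α ∘ ⇑τ) ((α ∘ ⇑τ) ∘ ⇑(Equiv.swap (0 : Fin 3) 1)) w (Matrix.GeneralLinearGroup.mkOfDetNeZero (Matrix.diagonal ![((Real.sqrt ((w.1.embedding ((α ∘ ⇑τ) 0)).re / (w.1.embedding ((α ∘ ⇑τ) 1)).re) : ℝ) : ℂ), ((Real.sqrt ((w.1.embedding ((α ∘ ⇑τ) 1)).re / (w.1.embedding ((α ∘ ⇑τ) 0)).re) : ℝ) : ℂ), 1]) (det_rescale01_ne_zero h01s)) (formCongr_rescale01_map_diagonal L (α ∘ ⇑τ) w (fun i => hreal w (τ i)) h01s))).toMulEquiv (Subgroup.centralizer ({(⟨circleDiagonal 3 (z₁ w), circleDiagonal_mem_archLocal_diagonal L 3 (α ∘ ⇑τ) w (z₁ w)⟩ : archLocal L 3 (Matrix.diagonal (α ∘ ⇑τ)) w)} : Set (archLocal L 3 (Matrix.diagonal (α ∘ ⇑τ)) w))) (Subgroup.centralizer ({(⟨circleDiagonal 3 (z₁ w), circleDiagonal_mem_archLocal_diagonal L 3 ((α ∘ ⇑τ) ∘ ⇑(Equiv.swap (0 : Fin 3) 1)) w (z₁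 w)⟩ : archLocal L 3 (Matrix.diagonal ((α ∘ ⇑τ) ∘ ⇑(Equiv.swap (0 : Fin 3) 1))) w)} : Set (archLocal L 3 (Matrix.diagonal ((α ∘ ⇑τ) ∘ ⇑(Equiv.swap (0 : Fin 3) 1))) w))) (forall_apply_mem_centralizer_singleton_iff_of_eq (ContinuousMulEquiv.restrictSubgroup (GLn.conjEquiv (Matrix.GeneralLinearGroup.mkOfDetNeZero (Matrix.diagonal ![((Real.sqrt ((w.1.embedding ((α ∘ ⇑τ) 0)).re / (w.1.embedding ((α ∘ ⇑τ) 1)).re) : ℝ) : ℂ), ((Real.sqrt ((w.1.embedding ((α ∘ ⇑τ) 1)).re / (w.1.embedding ((α ∘ ⇑τ) 0)).re) : ℝ) : ℂ), 1]) (det_rescale01_ne_zero h01s))) (archLocal L 3 (Matrix.diagonal (α ∘ ⇑τ)) w) (archLocal L 3 (Matrix.diagonal ((α ∘ ⇑τ) ∘ ⇑(Equiv.swap (0 : Fin 3) 1))) w) (mem_archLocal_diagonal_iff_conjEquiv_mem_of_formCongr_eq L 3 (α ∘ ⇑τ) ((α ∘ ⇑τ) ∘ ⇑(Equiv.swap (0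 : Fin 3) 1)) w (Matrix.GeneralLinearGroup.mkOfDetNeZero (Matrix.diagonal ![((Real.sqrt ((w.1.embedding ((α ∘ ⇑τ) 0)).re / (w.1.embedding ((α ∘ ⇑τ) 1)).re) : ℝ) : ℂ), ((Real.sqrt ((w.1.embedding ((α ∘ ⇑τ) 1)).re / (w.1.embedding ((α ∘ ⇑τ) 0)).re) : ℝ) : ℂ), 1]) (det_rescale01_ne_zero h01s)) (formCongr_rescale01_map_diagonal L (α ∘ ⇑τ) w (fun i => hreal w (τ i)) h01s))).toMulEquiv (congrT_circleDiagonal L 3 (α ∘ ⇑τ) ((α ∘ ⇑τ) ∘ ⇑(Equiv.swap (0 : Fin 3) 1)) w (Matrix.GeneralLinearGroup.mkOfDetNeZero (Matrix.diagonal ![((Real.sqrt ((w.1.embedding ((α ∘ ⇑τ) 0)).re / (w.1.embedding ((α ∘ ⇑τ) 1)).re) : ℝ) : ℂ), ((Real.sqrt ((w.1.embedding ((α ∘ ⇑τ) 1)).re / (w.1.embedding ((α ∘ ⇑τ) 0)).re) : ℝ) : ℂ), 1]) (det_rescale01_ne_zero h01s)) (formCongr_rescale01_map_diagonal L (α ∘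 ⇑τ) w (fun i => hreal w (τ i)) h01s) (rescale01_conj_circleDiagonal L (α ∘ ⇑τ) w h01s) (z₁ w))) (ContinuousMulEquiv.restrictSubgroup (GLn.conjEquiv (Matrix.GeneralLinearGroup.mkOfDetNeZero (Matrix.diagonal ![((Real.sqrt ((w.1.embedding ((α ∘ ⇑τ) 0)).re / (w.1.embedding ((α ∘ ⇑τ) 1)).re) : ℝ) : ℂ), ((Real.sqrt ((w.1.embedding ((α ∘ ⇑τ) 1)).re / (w.1.embedding ((α ∘ ⇑τ) 0)).re) : ℝ) : ℂ), 1]) (det_rescale01_ne_zero h01s))) (archLocal L 3 (Matrix.diagonal (α ∘ ⇑τ)) w) (archLocal L 3 (Matrix.diagonal ((α ∘ ⇑τ) ∘ ⇑(Equiv.swap (0 : Fin 3) 1))) w) (mem_archLocal_diagonal_iff_conjEquiv_mem_of_formCongr_eq L 3 (α ∘ ⇑τ) ((α ∘ ⇑τ) ∘ ⇑(Equiv.swap (0 : Fin 3) 1)) w (Matrix.GeneralLinearGroup.mkOfDetNeZero (Matrix.diagonal ![((Real.sqrt ((w.1.embedding ((α ∘ ⇑τ) 0)).re / (w.1.embedding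 ((α ∘ ⇑τ) 1)).re) : ℝ) : ℂ), ((Real.sqrt ((w.1.embedding ((α ∘ ⇑τ) 1)).re / (w.1.embedding ((α ∘ ⇑τ) 0)).re) : ℝ) : ℂ), 1]) (det_rescale01_ne_zero h01s)) (formCongr_rescale01_map_diagonal L (α ∘ ⇑τ) w (fun i => hreal w (τ i)) h01s))).continuous (ContinuousMulEquiv.restrictSubgroup (GLn.conjEquiv (Matrix.GeneralLinearGroup.mkOfDetNeZero (Matrix.diagonal ![((Real.sqrt ((w.1.embedding ((α ∘ ⇑τ) 0)).re / (w.1.embedding ((α ∘ ⇑τ) 1)).re) : ℝ) : ℂ), ((Real.sqrt ((w.1.embedding ((α ∘ ⇑τ) 1)).re / (w.1.embedding ((α ∘ ⇑τ) 0)).re) : ℝ) : ℂ), 1]) (det_rescale01_ne_zero h01s))) (archLocal L 3 (Matrix.diagonal (α ∘ ⇑τ)) w) (archLocal L 3 (Matrix.diagonal ((α ∘ ⇑τ) ∘ ⇑(Equiv.swap (0 : Fin 3) 1))) w) (mem_archLocal_diagonal_iff_conjEquiv_mem_of_formCongr_eq L 3 (α ∘ ⇑τ) ((α ∘ ⇑τ)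 ∘ ⇑(Equiv.swap (0 : Fin 3) 1)) w (Matrix.GeneralLinearGroup.mkOfDetNeZero (Matrix.diagonal ![((Real.sqrt ((w.1.embedding ((α ∘ ⇑τ) 0)).re / (w.1.embedding ((α ∘ ⇑τ) 1)).re) : ℝ) : ℂ), ((Real.sqrt ((w.1.embedding ((α ∘ ⇑τ) 1)).re / (w.1.embedding ((α ∘ ⇑τ) 0)).re) : ℝ) : ℂ), 1]) (det_rescale01_ne_zero h01s)) (formCongr_rescale01_map_diagonal L (α ∘ ⇑τ) w (fun i => hreal w (τ i)) h01s))).symm.continuous))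
    {κ : Type*} (z0 : κ → {w : InfinitePlace L // IsComplex w} → Fin 3 → Circle) (hinj : Function.Injective z0)
    (hwall : ∀ k w, z0 k w 0 = z0 k w 2 ∧ z0 k w 0 ≠ z0 k w 1)
    (ρZ : ∀ (k : κ) (w : {w : InfinitePlace L // IsComplex w}) (σ : Perm (Fin 3)), Measure (Subgroup.centralizer ({(⟨circleDiagonal 3 (z0 k w ∘ ⇑σ), circleDiagonal_mem_archLocal_diagonal L 3 α w (z0 k w ∘ ⇑σ)⟩ : archLocal L 3 (Matrix.diagonal α) w)} : Set (archLocal L 3 (Matrix.diagonal α) w))))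
    (hρZi : ∀ k w σ, (ρZ k w σ).IsHaarMeasure ∧ (ρZ k w σ).IsInvInvariant)
    (hρZ : ∀ (k : κ) (w : {w : InfinitePlace L // IsComplex w}) (σ : Perm (Fin 3)), ¬ 0 < (w.1.embedding (α (σ⁻¹ 0))).re * (w.1.embedding (α (σ⁻¹ 2))).re →
      ρZ k w σ = (νH w σ⁻¹).map (subgroupCongrHomeomorph (ContinuousMulEquiv.restrictSubgroup (GLn.conjEquiv (Matrix.GeneralLinearGroup.mkOfDetNeZero _ (det_monomial_one_ne_zero 3 σ⁻¹)))
        (archLocal L 3 (Matrix.diagonal (α ∘ ⇑σ⁻¹)) w) (archLocal L 3 (Matrix.diagonal α) w) (mem_archLocal_comp_perm_iff_conj_mem L 3 α w σ⁻¹)).toMulEquiv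
        (Subgroup.centralizer ({(⟨circleDiagonal 3 (z₁ w), circleDiagonal_mem_archLocal_diagonal L 3 (α ∘ ⇑σ⁻¹) w (z₁ w)⟩ : archLocal L 3 (Matrix.diagonal (α ∘ ⇑σ⁻¹)) w)} : Set (archLocal L 3 (Matrix.diagonal (α ∘ ⇑σ⁻¹)) w)))
        (Subgroup.centralizer ({(⟨circleDiagonal 3 (z0 k w ∘ ⇑σ), circleDiagonal_mem_archLocal_diagonal L 3 α w (z0 k w ∘ ⇑σ)⟩ : archLocal L 3 (Matrix.diagonal α) w)} : Set (archLocal L 3 (Matrix.diagonal α) w)))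
        (relabel_inv_mem_centralizer_circleDiagonal_comp_iff L α w σ (h02 w) (h01 w) (hwall k w).1 (hwall k w).2)
        (ContinuousMulEquiv.restrictSubgroup (GLn.conjEquiv (Matrix.GeneralLinearGroup.mkOfDetNeZero _ (det_monomial_one_ne_zero 3 σ⁻¹)))
          (archLocal L 3 (Matrix.diagonal (α ∘ ⇑σ⁻¹)) w) (archLocal L 3 (Matrix.diagonal α) w) (mem_archLocal_comp_perm_iff_conj_mem L 3 α w σ⁻¹)).continuous
        (ContinuousMulEquiv.restrictSubgroup (GLn.conjEquiv (Matrix.GeneralLinearGroup.mkOfDetNeZero _ (det_monomial_one_ne_zero 3 σ⁻¹)))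
          (archLocal L 3 (Matrix.diagonal (α ∘ ⇑σ⁻¹)) w) (archLocal L 3 (Matrix.diagonal α) w) (mem_archLocal_comp_perm_iff_conj_mem L 3 α w σ⁻¹)).symm.continuous))
    (hρZ1 : ∀ (k : κ) (w : {w : InfinitePlace L // IsComplex w}) (σ : Perm (Fin 3)), 0 < (w.1.embedding (α (σ⁻¹ 0))).re * (w.1.embedding (α (σ⁻¹ 2))).re → ρZ k w σ Set.univ = 1) :
    ∃ (ρP : ∀ (k : κ) (ρ : {w : InfinitePlace L // IsComplex w} → Perm (Fin 3)), Measure (Subgroup.pi Set.univ (fun w : {w : InfinitePlace L // IsComplex w} => Subgroup.centralizer ({(⟨circleDiagonal 3 (z0 k w ∘ ⇑(ρ w)), circleDiagonal_mem_archLocal_diagonal L 3 α w (z0 k w ∘ ⇑(ρ w))⟩ : archLocal L 3 (Matrix.diagonal α) w)} : Set (archLocal L 3 (Matrix.diagonal α) w)))))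
      (ρ' : ∀ (k : κ) (ρ : {w : InfinitePlace L // IsComplex w} → Perm (Fin 3)), Measure (Subgroup.centralizer ({archDiagTorus L 3 α (fun w => z0 k w ∘ ⇑(ρ w))} : Set (arch (↥(maximalRealSubfield L)) L (IsCMField.complexConj L) 3 (Matrix.diagonal α)))))
      (T : ∀ γ : arch (↥(maximalRealSubfield L)) L (IsCMField.complexConj L) 3 (Matrix.diagonal α), Measure (Subgroup.centralizer ({γ} : Set (arch (↥(maximalRealSubfield L)) L (IsCMField.complexConj L) 3 (Matrix.diagonal α))))),
      (∀ k ρ, (ρP k ρ).IsHaarMeasure ∧ (ρP k ρ).IsInvInvariant) ∧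
      (∀ (k : κ) (ρ : {w : InfinitePlace L // IsComplex w} → Perm (Fin 3)), Measure.map (subgroupPiCoords fun w : {w : InfinitePlace L // IsComplex w} => Subgroup.centralizer ({(⟨circleDiagonal 3 (z0 k w ∘ ⇑(ρ w)), circleDiagonal_mem_archLocal_diagonal L 3 α w (z0 k w ∘ ⇑(ρ w))⟩ : archLocal L 3 (Matrix.diagonal α) w)} : Set (archLocal L 3 (Matrix.diagonal α) w))) (ρP k ρ) = Measure.pi fun w => ρZ k w (ρ w)) ∧
      (∀ k ρ, (ρ' k ρ).IsHaarMeasure ∧ (ρ' k ρ).IsInvInvariant) ∧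
      (∀ (k : κ) (ρ : {w : InfinitePlace L // IsComplex w} → Perm (Fin 3)), ρ' k ρ = (ρP k ρ).map (subgroupCongrHomeomorph (archPiEquivCM 3 L (Matrix.diagonal α)).symm.toMulEquiv (Subgroup.pi Set.univ (fun w : {w : InfinitePlace L // IsComplex w} => Subgroup.centralizer ({(⟨circleDiagonal 3 (z0 k w ∘ ⇑(ρ w)), circleDiagonal_mem_archLocal_diagonal L 3 α w (z0 k w ∘ ⇑(ρ w))⟩ : archLocal L 3 (Matrix.diagonal α) w)} : Set (archLocal L 3 (Matrix.diagonal α) w)))) (Subgroup.centralizer ({archDiagTorus L 3 α (fun w => z0 k w ∘ ⇑(ρ w))} : Set (arch (↥(maximalRealSubfield L)) L (IsCMField.complexConj L) 3 (Matrix.diagonal α)))) (apply_mem_centralizer_iff_mem_pi_centralizer _ (archPiEquivCM 3 L (Matrix.diagonal α)).symm.toMulEquiv (archPiEquivCM_symm_circleDiagonal_eq_archDiagTorus L 3 α (fun w => z0 k w ∘ ⇑(ρ w)))) (archPiEquivCM 3 L (Matrix.diagonal α)).symm.continuous (archPiEquivCM 3 L (Matrix.diagonal α)).continuous)) ∧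
      (∀ (k : κ) (ρ : {w : InfinitePlace L // IsComplex w} → Perm (Fin 3)), T (archDiagTorus L 3 α (fun w => z0 k w ∘ ⇑(ρ w))) = ρ' k ρ) ∧
      (∀ γ : arch (↥(maximalRealSubfield L)) L (IsCMField.complexConj L) 3 (Matrix.diagonal α), (∃ (k : κ) (ρ : {w : InfinitePlace L // IsComplex w} → Perm (Fin 3)) (q : arch (↥(maximalRealSubfield L)) L (IsCMField.complexConj L) 3 (Matrix.diagonal α)), (MulAut.conj q : arch (↥(maximalRealSubfield L)) L (IsCMField.complexConj L) 3 (Matrix.diagonal α) ≃* arch (↥(maximalRealSubfield L)) L (IsCMField.complexConj L) 3 (Matrix.diagonal α)) (archDiagTorus L 3 α (fun w => z0 k w ∘ ⇑(ρ w))) = γ) →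
        ∃ (k : κ) (ρ : {w : InfinitePlace L // IsComplex w} → Perm (Fin 3)) (q : arch (↥(maximalRealSubfield L)) L (IsCMField.complexConj L) 3 (Matrix.diagonal α)) (h : (MulAut.conj q : arch (↥(maximalRealSubfield L)) L (IsCMField.complexConj L) 3 (Matrix.diagonal α) ≃* arch (↥(maximalRealSubfield L)) L (IsCMField.complexConj L) 3 (Matrix.diagonal α)) (archDiagTorus L 3 α (fun w => z0 k w ∘ ⇑(ρ w))) = γ), T γ = (ρ' k ρ).map (subgroupCongrHomeomorph (MulAut.conj q : arch (↥(maximalRealSubfield L)) L (IsCMField.complexConj L) 3 (Matrix.diagonal α) ≃* arch (↥(maximalRealSubfield L)) L (IsCMField.complexConj L) 3 (Matrix.diagonal α)) (Subgroup.centralizer ({archDiagTorus L 3 α (fun w => z0 k w ∘ ⇑(ρ w))} : Set (arch (↥(maximalRealSubfield L)) L (IsCMField.complexConj L) 3 (Matrix.diagonal α)))) (Subgroup.centralizer ({γ} : Set (arch (↥(maximalRealSubfield L)) L (IsCMField.complexConj L) 3 (Matrix.diagonal α)))) (forall_apply_mem_centralizer_singleton_iff_of_eq (MulAut.conj q : arch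 (↥(maximalRealSubfield L)) L (IsCMField.complexConj L) 3 (Matrix.diagonal α) ≃* arch (↥(maximalRealSubfield L)) L (IsCMField.complexConj L) 3 (Matrix.diagonal α)) h) (continuous_mulAutConj q) (continuous_mulAutConj_symm q))) ∧
      (∀ γ : arch (↥(maximalRealSubfield L)) L (IsCMField.complexConj L) 3 (Matrix.diagonal α), (∃ (k : κ) (ρ : {w : InfinitePlace L // IsComplex w} → Perm (Fin 3)) (q : arch (↥(maximalRealSubfield L)) L (IsCMField.complexConj L) 3 (Matrix.diagonal α)), (MulAut.conj q : arch (↥(maximalRealSubfield L)) L (IsCMField.complexConj L) 3 (Matrix.diagonal α) ≃* arch (↥(maximalRealSubfield L)) L (IsCMField.complexConj L) 3 (Matrix.diagonal α)) (archDiagTorus L 3 α (fun w => z0 k w ∘ ⇑(ρ w))) = γ) → (T γ).IsHaarMeasure ∧ (T γ).IsInvInvariant) ∧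
      ∀ (γ₁ γ₂ Q : arch (↥(maximalRealSubfield L)) L (IsCMField.complexConj L) 3 (Matrix.diagonal α)) (hQ : (MulAut.conj Q : arch (↥(maximalRealSubfield L)) L (IsCMField.complexConj L) 3 (Matrix.diagonal α) ≃* arch (↥(maximalRealSubfield L)) L (IsCMField.complexConj L) 3 (Matrix.diagonal α)) γ₁ = γ₂), (∃ (k : κ) (ρ : {w : InfinitePlace L // IsComplex w} → Perm (Fin 3)) (q : arch (↥(maximalRealSubfield L)) L (IsCMField.complexConj L) 3 (Matrix.diagonal α)), (MulAut.conj q : arch (↥(maximalRealSubfield L)) L (IsCMField.complexConj L) 3 (Matrix.diagonal α) ≃* arch (↥(maximalRealSubfield L)) L (IsCMField.complexConj L) 3 (Matrix.diagonal α)) (archDiagTorus L 3 α (fun w => z0 k w ∘ ⇑(ρ w))) = γ₁) →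
        (T γ₁).map (subgroupCongrHomeomorph (MulAut.conj Q : arch (↥(maximalRealSubfield L)) L (IsCMField.complexConj L) 3 (Matrix.diagonal α) ≃* arch (↥(maximalRealSubfield L)) L (IsCMField.complexConj L) 3 (Matrix.diagonal α)) (Subgroup.centralizer ({γ₁} : Set (arch (↥(maximalRealSubfield L)) L (IsCMField.complexConj L) 3 (Matrix.diagonal α)))) (Subgroup.centralizer ({γ₂} : Set (arch (↥(maximalRealSubfield L)) L (IsCMField.complexConj L) 3 (Matrix.diagonal α)))) (forall_apply_mem_centralizer_singleton_iff_of_eq (MulAut.conj Q : arch (↥(maximalRealSubfield L)) L (IsCMField.complexConj L) 3 (Matrix.diagonal α) ≃* arch (↥(maximalRealSubfield L)) L (IsCMField.complexConj L) 3 (Matrix.diagonal α)) hQ) (continuous_mulAutConj Q) (continuous_mulAutConj_symm Q)) = T γ₂ :=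
  haveI : ∀ w : {w : InfinitePlace L // IsComplex w}, SecondCountableTopology (archLocal L 3 (Matrix.diagonal α) w) := fun w => secondCountableTopology_archLocal L 3 (Matrix.diagonal α) w
  haveI : ∀ w : {w : InfinitePlace L // IsComplex w}, LocallyCompactSpace (archLocal L 3 (Matrix.diagonal α) w) := fun w => locallyCompactSpace_archLocal L 3 (Matrix.diagonal α) w
  exists_conj_coherent_pinned_telescope_all L α z0 hinj hwall ρZ hρZi (fun k w σ₁ σ₂ g hg =>
    centralizer_measure_family_conj_coherent L α w hα (hreal w) (h02 w) (h01 w) (hwall k w).1 (hwall k w).2 (νH w) (hT02 w) (hT01 w) (ρZ k w) (hρZ k w) (hρZi k w)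
      (hρZ1 k w) σ₁ σ₂ g hg)

end Pins

end Literature.NumberTheory.Rogawski1990

end
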